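import Summits.QuantumFields.BalabanUV.T4Continuum.Spine.NE1p.DressedTransportAssembledWitnessBinders

/-!
# T⁴ programme, spine estimate NE1′ (node O3b/H2) — NON-VACUITY OF END-F″∕END-F′ (DAG node N22), part 3 of 3: END-F″ BY NAME ON
# THE DATUM, THEN END-B's PER-CUTOFF FACE; THE GATE IS A GENUINE CONSTRAINT (formalisation crew
# `b2b-balaban-t4-ne1p-formalise-*`, leaf seat 03, row W2)

ADDITIVE — imports part 2 `…DressedTransportAssembledWitnessBinders` ONLY.  Part 1's module docstring carries the WHY and the
datum.

THIS PART.  §5 **`transportsFromVar_assembled`**: `DressedTransportAssembledData.transportLeaf_assembled_canonical` (END-F″,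
leaf-01; it feeds END-F′ `transportLeaf_assembled` with the canonical `rsOf`∕`aszOf`∕`s1Of`) applied ON THE DATUM with ALL 37
hypothesis binders discharged — gate `budgetGate TrA sA mA SA (4c_δ/r) (ψ·α)` ITSELF (not `True`), constants `c_δ = defect = 1/5`,
`ψ = w = θ = 1`, `r = 4`, `r_* = 1`, `α ≡ 128` (`hdom` by `5e³ ≤ 128`), `m = 2⁻²⁴`, `‖c‖·r = m·r_*`; conclusion = the field type of
`BookingLeaves.htr` at `C = 4·(1/5)/4`, `ρ ≡ 1·128`.  §6 `assembledConstants` — ONE rational `UniformConstants`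
`(C, A₀, ρ₁, τ, Λ, N₀, ρ′, s̄⁰, m) = (1/5, 64, 128, 1, 1/256, 65536, 1/2, 1/2, 2⁻²⁴)` with (w7) `Λρ₁τ = ρ′` and (w6)
`m·N₀A₀(1−ρ′)⁻¹ = 1 − s̄⁰` EQUALITIES; `assembledLeaves : BookingLeaves assembledConstants Bk TrA` with
**`htr := transportsFromVar_assembled`**; **`classAt_through_ENDF''`** `:= classAt_of_bookingLeaves assembledLeaves` — END-F″ THEN
END-B's per-cutoff face exercised end to end at function level; `budgetGate_holds`; **`not_budgetGate_of_unit_source`**: with source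
factor `m = 1` (all else equal) the gate FAILS at scale 0 (`½ + 38 > 1`) — (w6) `hsmall` is load-bearing, the history premises are
not vacuous by fiat.

WHAT THE THREE PARTS ARE NOT.  Not an estimate; not the tower-level witness (every cutoff with one `U` — that is
`DressedRootWitness`, booking level); nothing of Bałaban's densities; the wall (w1)–(w7) of the record `t4/T4-EST-NE1p-P1.md` §4 is
unchanged.  VALUE = a joint-satisfiability certificate for END-F″'s 37 binders (hence END-F′'s, with canonical data) together with
END-B's per-cutoff leaf binders and a non-trivial dressed budget.

HONEST FRAMING.  Rung (B)+1 bookkeeping on ONE finite four-torus of fixed physical size — NOT infinite volume, NOT a mass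
gap, NOT OS on ℝ⁴, NOT the Clay problem, NOT summit progress.  NE1′ is NOT PRINTED and NOT PROVED; every headline reads
«NE1′ ⇐ the named binders» / «L-T ⇐ F-1…F-9»; spine PROVED 0∕9 unchanged.  A TOY: nothing of Bałaban's densities or of
[Balaban1989LargeFieldII] (1.71)–(1.75) pp. 379–380 is encoded (CONTEXT only, carried by the imported headers); no
`def … : Prop`; every declaration is [folklore] toy kernel mathematics, 0 sorry, 0 citations.  HONEST DEPENDENCY: continuum YM
on T⁴ ⇐ BetaPertH ∧ nine spine estimates (0/9 proved); BetaPertH ⇐ (D1) ∧ (D4) ∧ CAP+tail; G-an2-4 gates asym, D1 and NE2/3/4.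
-/

noncomputable section

namespace Summit.QuantumFields.BalabanUV.T4Continuum.NE1p.DressedTransportAssembledWitness

open MeasureTheory Set Metric Filter Finset
open scoped BigOperators
open Literature.MathematicalPhysics.QuantumFieldTheory.Balaban1983to89
open Literature.MathematicalPhysics.QuantumFieldTheory.Balaban1983to89.T4TermFormat
open Literature.MathematicalPhysics.QuantumFieldTheory.Balaban1983to89.T4TermFormat.Booking
open Literature.MathematicalPhysics.QuantumFieldTheory.Balaban1983to89.T4GatedBooking
open Literature.MathematicalPhysics.QuantumFieldTheory.Balaban1983to89.T4TrajectoryComparison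
open T4TrajectoryModulus (bondBall bondBall_add_mem bondBall_latMove_add_mem bondBall_diam)
open T4BlockTransport (Fld NDir latMove latN Site norm_dir_le)
open T4BirthChartTransport (GaugeInvariant BirthSlice RelGauge)
open T4TrajectoryDensity
open Summit.QuantumFields.BalabanUV.T4Continuum.T4TrajectoryDensityDressed
open Summit.QuantumFields.BalabanUV.T4Continuum.T4TrajectoryDensityWitness
open Summit.QuantumFields.BalabanUV.T4Continuum.NE1p.DressedRoot
open Summit.QuantumFields.BalabanUV.T4Continuum.NE1p.DressedTransportAssembledData

/-! ## §5 END-F″ on the datum: the transport leaf `htr` BY NAME, gated by the dressed budget -/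

/-- **THE JOINT WITNESS FOR END-F″ `transportLeaf_assembled_canonical` — ALL 37 hypothesis binders discharged at once on the datum,
the gate being the dressed budget `budgetGate TrA sA mA SA (4c_δ/r) (ψ·α)` itself, the observable-attached exponent GIVEN BY THE
ASSEMBLY'S DICTIONARY `hQ` with a live generation at both met steps (the dressed functional `Fn 0 1` inside the exponent at step 1),
genuine fresh pairs at both atoms, canonical sizes/budgets `aszOf`/`s1Of` by name.**  Conclusion = END-F″'s = END-F's, i.e. the field
type of `BookingLeaves.htr` at `C = 4·(1/5)/4`, `ρ ≡ 1·128`. [folklore] -/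
theorem transportsFromVar_assembled :
    TrA.TransportsFromVar (4 * (1 / 5) / 4) (fun _ => (1 : ℝ) * 128)
      (budgetGate TrA sA mA SA (4 * (1 / 5) / 4) (fun _ => (1 : ℝ) * 128)) :=
  transportLeaf_assembled_canonical (T := TrA) (Fn := fun _ k' k => Fn k' k)
    (rel := fun _ _ _ U U' => U = U') (𝒦 := fun _ _ k => WinA k) (ref := fun _ _ => ref₁) (base := fun _ _ => base₁)
    (𝒜 := fun b k => 𝒜A k b) (𝒬 := fun b k => 𝒬A k b) (q := fun _ _ => qA) (μ := fun _ _ => flTwo) (z₀ := fun _ _ => 0)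
    (z₁ := fun _ _ => z₁A) (D := fun _ _ => Dfl) (defect := fun _ _ _ => 1 / 5) (cδ := 1 / 5) (ψ := 1) (w := 1) (r := 4)
    (rstar := 1) (m := mA) (s := sA) (θ := fun _ _ => 1) (ϱ₁ := fun _ k => ϱ₁A k) (α := fun _ => 128)
    (ϱ := fun _ _ k => ϱA k) (S := SA) (Sg := SgA) (c := fun _ _ => cA) (δf := fun _ _ _ => δfA)
    (fun _ => by norm_num) (by norm_num) one_pos (by norm_num) zero_le_one one_pos (by norm_num)
    (fun b k' hb hk hran => hsl_A b k' _ hb hk hran)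
    (fun b k' k _ hk'k _ _ U => by rw [𝒜A_add_𝒬A]; exact Fn_succ hk'k U)
    (fun _ _ _ _ _ _ _ _ => mem_bddClass _) (fun _ _ => ⟨0, zero_mem_Dfl⟩) (fun _ _ k => ϱA_pos k)
    (fun b _ k _ _ hk _ => realBaseAt_A (by change k + 1 ≤ 2 at hk; omega) b
      (by simp only [radA]; push_cast; linarith))
    (fun b _ k _ _ hk _ => by
      have hk1 : k ≤ 1 := by change k + 1 ≤ 2 at hk; omega
      interval_cases k
      · exact exponentSliceAt_A_zero b (by norm_num [radA])
      · exact exponentSliceAt_A_one b (by norm_num [radA]))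
    (fun b k => by funext U z; simp only [𝒬A, add_sub_cancel_left])
    hSg_A
    (fun _ k'' _ => (ϱA_le_three k'').trans_lt (by norm_num))
    (fun _ _ k _ _ => ϱA_succ_lt k)
    (fun _ _ k _ _ => one_le_ϱA k)
    (fun b _ k _ _ => hmargin_A b k)
    (fun _ _ => by rw [norm_cA, mA]; norm_num)
    (fun _ k p _ => ⟨by norm_num [δfA], by norm_num [δfA]⟩)
    (fun _ _ _ _ => by norm_num [δfA])
    (fun _ _ => ae_two.mpr ⟨zero_mem_Dfl, atomH_mem_Dfl⟩)
    (fun _ _ k _ _ _ => bondBall_add_mem (ρ' := radA (k + 1)) (s := 1 / 2) (ρ := radA k)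
      (by simp only [radA]; push_cast; linarith))
    (fun _ _ k _ _ _ => bondBall_latMove_add_mem (ρ' := radA (k + 1)) (w := 1) (s := 1 / 2) (ρ := radA k)
      (by simp only [radA]; push_cast; linarith))
    (fun _ _ k _ _ _ _ => bondBall_add_mem (ρ' := radA (k + 1)) (s := 1 / 2) (ρ := radA k)
      (by simp only [radA]; push_cast; linarith))
    (fun _ _ k _ _ _ _ U₀ hU₀ pd hpd hpdw t ht =>
      bondBall_complexMargin (ρ' := radA (k + 1)) (w := 1) (ϱ₁ := ϱ₁A k) (s := 1 / 2) (ρ := radA k) (ϱ₁A_pos k).le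
        (by have := ϱ₁A_le_four k; simp only [radA]; push_cast; linarith) U₀ hU₀ pd hpd hpdw t ht z₁A z₁A_mem)
    (fun _ _ _ _ _ _ _ U₀ _ pd _ _ => ae_two.mpr
      ⟨fun t _ => relGauge_pair (latMove U₀ pd t) 0 (Or.inl rfl), fun t _ => relGauge_pair (latMove U₀ pd t) atomH (Or.inr rfl)⟩)
    (fun _ _ z hz z' hz' x ν => by have h := bondBall_diam (s := 1 / 2) z hz z' hz' x ν; linarith)
    (fun _ _ => ⟨one_pos, le_rfl⟩)
    (fun _ _ k _ _ _ => by
      have h1 := one_le_ϱA k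
      have h4 : 4 * (1 : ℝ) / ϱA k ≤ 4 := by
        rw [div_le_iff₀ (ϱA_pos k)]; linarith
      nlinarith [five_mul_exp_three_le, Real.exp_pos 3])
    (fun _ _ _ _ _ h => h ▸ rfl)
    (fun _ _ _ _ _ => aesm_two _)
    (fun _ _ _ => by norm_num) (fun _ _ _ _ _ _ => by norm_num)
    (fun b k' k hb hk'k hk hran => hlin_A b k' k _ hb hk'k hk hran)

/-- Its reading at `(k′, k) = (0, 2)` under the dressed history: the unit booked size against the two-step transport of the birth
size `190` at rate `128` with constant `1/5`. [folklore] -/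
example (hran : RanBelow (budgetGate TrA sA mA SA (4 * (1 / 5) / 4) (fun _ => (1 : ℝ) * 128)) 2) :
    (1 : ℝ) ≤ 4 * (1 / 5) / 4 * stepProd (fun _ => (1 : ℝ) * 128) 0 2 * 190 :=
  transportsFromVar_assembled () 0 2 le_rfl (by norm_num) le_rfl hran

/-! ## §6 END-B's per-cutoff face behind END-F″: one rational `UniformConstants`, the leaf binders, the class and the gates -/

/-- THE CONSTANTS [decided toy]: `C = 4·(1/5)/4` (END-F″'s `4c_δ/r`), `A₀ = 64` (`≥ C·gen = 38` at birth), `ρ₁ = 128` (= `ψ·α`, no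
regeneration), `τ = 1`, `Λ = 1/256`, `N₀ = 65536 = 256²`, `ρ′ = 1/2` with (w7) `Λρ₁τ = ρ′` an equality, `s̄⁰ = 1/2`, `m = 2⁻²⁴`
with (w6) `m·N₀A₀(1−ρ′)⁻¹ = 1/2 = 1 − s̄⁰` an equality.  All rational, K- and μ-free. [folklore] -/
def assembledConstants : UniformConstants where
  C := 4 * (1 / 5) / 4
  A₀ := 64
  ρ₁ := 128
  τ := 1
  Λ := 1 / 256
  N₀ := 65536
  ρ' := 1 / 2
  sbar := 1 / 2
  m := mA
  hC := by norm_num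
  hA₀ := by norm_num
  hρ₁ := by norm_num
  hτ0 := by norm_num
  hτ1 := le_rfl
  hΛ := by norm_num
  hN₀ := by norm_num
  hm := by norm_num [mA]
  hρ'1 := by norm_num
  hprod := by norm_num
  hsmall := by norm_num [mA]

/-- **THE LEAF BINDERS AT THE CUTOFF `K = 2`, WITH `htr` SUPPLIED BY END-F″ AT FUNCTION LEVEL** [decided toy]: rates `ψ·α ≡ 128`,
no regeneration, action margins `sA ≡ ½`, live families `SA`; (w7) `hrate` with equality, (w3-book) `hS`/`hcount`
(`1 ≤ 65536·256^{−(k−j)}` for `k − j ≤ 2`), (w2-act) `hs₀`, (w1) `hbirth` history-free through `Trajectory.birthsFromOld_of_diag`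
(`C·190 = 38 ≤ 64 = twoRate 64 128 1 2 0 0`), **T `htr := transportsFromVar_assembled`** (§5, END-F″ by name), (w5) `hreg` trivially.
[folklore] -/
def assembledLeaves : BookingLeaves assembledConstants Bk TrA where
  ρ := fun _ => (1 : ℝ) * 128
  c := fun _ => 0
  s₀ := sA
  S := SA
  hρ := fun _ => by norm_num
  hc := fun _ => le_rfl
  hrate := fun _ _ => by
    show (1 : ℝ) * 128 + 4 * (1 / 5) / 4 * 0 ≤ 128
    norm_num
  hS := fun k _ _ _ => Nat.zero_le k
  hcount := fun k b j hj => by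
    show (((SA k b).filter fun _ => (0 : ℕ) = j).card : ℝ) ≤ 65536 * (1 / 256) ^ (k - j)
    unfold SA
    split_ifs with hk
    · have h1 : ((({b} : Finset Bk.Birth).filter fun _ => (0 : ℕ) = j).card : ℝ) ≤ 1 := by
        exact_mod_cast (Finset.card_filter_le _ _).trans (Finset.card_singleton b).le
      have h2 : ((1 / 256 : ℝ)) ^ 2 ≤ (1 / 256 : ℝ) ^ (k - j) :=
        pow_le_pow_of_le_one (by norm_num) (by norm_num) (by omega)
      nlinarith
    · simp
  hs₀ := fun _ _ => by
    show (1 / 2 : ℝ) ≤ 1 / 2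
    exact le_rfl
  hbirth := Trajectory.birthsFromOld_of_diag fun b => by
    show 4 * (1 / 5) / 4 * TrA.gen b (Bk.birthScale b) ≤ twoRate 64 128 1 Bk.K (Bk.birthScale b) (Bk.birthScale b)
    rw [show Bk.birthScale b = 0 from rfl, show Bk.K = 2 from rfl, show TrA.gen b 0 = 190 from by simp [TrA, genA]]
    norm_num [twoRate]
  htr := transportsFromVar_assembled
  hreg := fun b k _ _ _ => by
    show TrA.gen b (k + 1) ≤ 0 * Bk.size b k
    rw [show TrA.gen b (k + 1) = 0 from by simp [TrA, genA], zero_mul]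

/-- **END-F″ THEN END-B's PER-CUTOFF FACE, AT FUNCTION LEVEL** [decided toy]: the booked observable-attached term of the datum lies in
the two-rate class `twoRate 64 128 1 2`, AND every dressed budget gate along the trajectory held — from `classAt_of_bookingLeaves` on
leaf binders whose transport leaf came through END-F″ (the Assembly's dictionary, canonical sizes, fresh pairs and all).  The joint
binder family {END-F″'s 37} ∪ {END-B's per-cutoff leaves} is inhabited on one datum with a non-trivial gate. [folklore] -/
theorem classAt_through_ENDF'' :
    ClassAt Bk 64 128 1 ∧
      ∀ k, k ≤ Bk.K → RanBelow (budgetGate TrA sA mA SA (4 * (1 / 5) / 4) (fun _ => (1 : ℝ) * 128)) k :=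
  classAt_of_bookingLeaves assembledLeaves

/-- In particular the dressed budget held at scales `0` and `1` (the two met steps). [folklore] -/
theorem budgetGate_holds {k : ℕ} (hk : k < 2) :
    budgetGate TrA sA mA SA (4 * (1 / 5) / 4) (fun _ => (1 : ℝ) * 128) k :=
  classAt_through_ENDF''.2 2 le_rfl k hk

/-- The booked envelope of the toy family at every scale is at least its birth term `(1/5)·190 = 38`. [folklore] -/
theorem envVar_ge (b : Bk.Birth) (k : ℕ) : (38 : ℝ) ≤ TrA.envVar (4 * (1 / 5) / 4) (fun _ => (1 : ℝ) * 128) b k := by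
  have h0 : (0 : ℕ) ∈ Finset.Icc (Bk.birthScale b) k := by
    show 0 ∈ Finset.Icc 0 k
    exact Finset.mem_Icc.mpr ⟨le_rfl, Nat.zero_le k⟩
  have hterm : (38 : ℝ) ≤ 4 * (1 / 5) / 4 * stepProd (fun _ => (1 : ℝ) * 128) 0 k * TrA.gen b 0 := by
    rw [stepProd_const, Nat.sub_zero, one_mul, show TrA.gen b 0 = 190 from by simp [TrA, genA]]
    have h1 : (1 : ℝ) ≤ (128 : ℝ) ^ k := one_le_pow₀ (by norm_num)
    linarith
  have hnn : ∀ k' ∈ Finset.Icc (Bk.birthScale b) k,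
      (0 : ℝ) ≤ 4 * (1 / 5) / 4 * stepProd (fun _ => (1 : ℝ) * 128) k' k * TrA.gen b k' := fun k' _ =>
    mul_nonneg (mul_nonneg (by norm_num) (by rw [stepProd_const]; positivity)) (TrA.gen_nonneg b k')
  refine hterm.trans ?_
  unfold Trajectory.envVar
  exact single_le_sum (f := fun k' => 4 * (1 / 5) / 4 * stepProd (fun _ => (1 : ℝ) * 128) k' k * TrA.gen b k') hnn h0

/-- **THE GATE IS A GENUINE CONSTRAINT ON THE DATUM**: with source factor `m = 1` instead of `2⁻²⁴` (all other data equal) the dressed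
budget FAILS at scale `0` (`½ + 1·38 > 1`) — (w6) `hsmall` is load-bearing; the history premises of END-F″'s binders are not vacuous
by fiat. [folklore] -/
theorem not_budgetGate_of_unit_source :
    ¬ budgetGate TrA sA 1 SA (4 * (1 / 5) / 4) (fun _ => (1 : ℝ) * 128) 0 := by
  intro h
  have h1 := h () le_rfl
  rw [sA, SA, if_pos (Nat.zero_le 2), sum_singleton, one_mul] at h1
  have h2 := envVar_ge () 0
  linarith

end Summit.QuantumFields.BalabanUV.T4Continuum.NE1p.DressedTransportAssembledWitness

end
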